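import Literature.NumberTheory.EllipticCurves.BinaryQuarticResolventFibres
import Literature.NumberTheory.EllipticCurves.BinaryQuarticDiscriminantLiftProofs
import Literature.NumberTheory.EllipticCurves.BinaryQuarticIrreducibleDiscProofs
import HarnessLib

/-!
# Transport of the uniformity estimate for `W_p^{(2)}` from `W_ℤ` to `V_ℤ`
# (Bhargava–Shankar, §2.6 of the published version: Thm 2.19 ⟹ `N(W_p^{(2)}(V); X) = O(X/p²)`)

Topic `Literature/NumberTheory/EllipticCurves`; sequel to `BinaryQuarticResolventEmbedding.lean`
(`φ(f) = (A₁, B_f)` on doubled Gram matrices, Thm 2.14 of the published version) and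
`BinaryQuarticResolventFibres.lean` (`W_ℤ = Pair`, the action `act` of `GL₂(ℤ) × SL₃(ℤ)`, the
doubled resolvent cubic form `twoRes`, and the fibre bound of Prop. 2.16:
`ncard_gl2zOrbits_fibre_le`).

Source: M. Bhargava, A. Shankar, *Binary quartic forms having bounded invariants, and the
boundedness of the average rank of elliptic curves*, Ann. of Math. (2) 181 (2015) 191–242, §2.6 of
the published version (= `arXiv:1006.1002v3`; theorem numbers below are the published ones). After
Thm 2.18 (strong divisibility, the geometric sieve) the source says:

> "However, a uniformity estimate for `W_p^{(2)}(V)`—the set of elements in `V_ℤ` having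
> discriminant divisible, but not strongly divisible, by `p²`—is more difficult to obtain. It is
> for this case that we consider the embedding (28) of `V_ℤ` into `W_ℤ`, where we can then use
> previously obtained uniformity estimates for `W_ℤ`. … **Theorem 2.19** ([dodqf, Prop. 23]) *Let
> `W_p^{(2)}(W)` denote the set of elements in `W_ℤ` whose discriminants are divisible, but not
> strongly divisible, by `p²`. Then the number of `GL₂(ℤ) × SL₃(ℤ)`-orbits on `W_p^{(2)}(W)` having
> discriminant bounded by `X` is `O(X/p²)`, where the implied constant is independent of `p`.* We
> may use this uniformity estimate for `W_p^{(2)}(W)` to obtain one for `W_p^{(2)}(V)`.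
> Specifically, in conjunction with Proposition 2.16, we obtain the estimate
> `N(W_p^{(2)}(V); X) = O(X/p²)`, where the implied constant is independent of `X` and `p`."

Here "strongly divisible" is as in §2.6: "the discriminant of `v ∈ V_ℤ` (resp. `w ∈ W_ℤ`) is
*strongly divisible* by `p²` if `p² ∣ Δ(v + pv')` (resp. `p² ∣ Δ(w + pw')`) for all `v' ∈ V_ℤ`
(resp. `w' ∈ W_ℤ`)", the discriminant of `(A, B) ∈ W_ℤ` being that of its resolvent binary cubic
form `4·Det(Ax − By)`, and "the map `φ` is discriminant preserving".

This file proves the transport step "Thm 2.19 + Prop. 2.16 ⟹ `N(W_p^{(2)}(V); X) = O(X/p²)`" in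
the following precise, unconditional form, leaving the two external inputs — Thm 2.19 itself
(= [dodqf, Prop. 23], a theorem about pairs of ternary quadratic forms / quartic rings) and the
Delone–Evertse bound on the number of solutions of a cubic Thue equation `g(x, y) = 1` used in
Prop. 2.16 — as explicit quantities/hypotheses rather than named facts:

* §1 `GEquiv`, `gOrbit`: the orbit relation of `GL₂(ℤ) × SL₃(ℤ)` on `W_ℤ` (an equivalence
  relation); `mem_fibre_iff`: the fibre of `BinaryQuarticResolventFibres` is `{B' : (2A₁, B') ~ P}`.
* §2 `ofQuartic f = (2A₁, 2B_f)` and `gEquiv_ofQuartic_of_gl2zEquiv`: `ψ : PGL₂(ℤ)\V_ℤ → (GL₂(ℤ) × SL₃(ℤ))\W_ℤ`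
  is well defined (eq. (28) of the published version, via Thm 2.14).
* §3 **the fibre-sum inequality** `ncard_gl2zOrbits_le`: for any set `S ⊆ V_ℤ`, if every `f ∈ S`
  admits a set of at most `D` pairs containing the solutions of `g_{φ(f)}(x, y) = 1`, then
  `#(GL₂(ℤ)-orbits met by S) ≤ 2·D·#(GL₂(ℤ) × SL₃(ℤ)-orbits met by φ(S))` — Prop. 2.16 summed over
  the image (with the factor `2` of `BinaryQuarticResolventFibres`).
* §4 **the discriminant on `W_ℤ`**: the doubled resolvent cubic `twoResCubic P` (coefficients of
  `Det(x·P₁ − y·P₂)`, `twoRes_eq_cubicForm`), `disc P := Disc(twoResCubic P)/16`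
  (`= Disc(4·Det(Ax − By))` for `P = (2A, 2B)`), "φ is discriminant preserving" (`disc_ofQuartic`:
  `disc (φ f) = Δ(f)`), and invariance under `GL₂(ℤ) × SL₃^{±}(ℤ)` (`disc_act`, through the
  classical covariance `discr_substCubic` of the cubic discriminant).
* §5 **strong divisibility**: `IsStronglySqDvd p P` (`p² ∣ disc(P + pP')` for all `P' ∈ W_ℤ`), its
  invariance under the action (`isStronglySqDvd_act_iff`), the sets `W_p^{(2)}(W)`
  (`TernaryPairs.weaklySqDvd p`, a union of orbits: `mem_weaklySqDvd_of_gEquiv`) and `W_p^{(2)}(V)`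
  (`BinaryQuartic.weaklySqDvd p`), and the transport `φ(W_p^{(2)}(V)) ⊆ W_p^{(2)}(W)`
  (`ofQuartic_mem_weaklySqDvd`: strong divisibility of `φ(f)` in `W` tested on the perturbations
  `(0, 2B_g)` is strong divisibility of `f` in `V`), also from `p ∤ ∂Δ/∂e`
  (`ofQuartic_mem_weaklySqDvd_of_not_dvd_discDerivE`).
* §6 **assembly**: `abs_disc_le_height` (`|Δ(f)| ≤ 8H(f)/27`), and `gl2zClassCount_le_of_thue`:
  for every `S` and `X`,
  `N(S; X) ≤ 2·D·#{(GL₂(ℤ) × SL₃(ℤ))·φ(f) : f ∈ S irreducible, H(f) < X}` whenever every integral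
  binary cubic form of nonzero discriminant takes the value `1` at most `D` times (Delone–Evertse:
  `D = 12`); with `image_gOrbit_ofQuartic_weaklySqDvd_subset`: for `S = W_p^{(2)}(V)` these orbits lie in
  `W_p^{(2)}(W)` and have discriminant `0 < |Disc| < 8X/27`. Feeding Thm 2.19 (a bound `C·X/p²` for
  the number of such orbits, with their finiteness) then gives `N(W_p^{(2)}(V); X) ≤ 2·D·C·X/p²`,
  the displayed estimate of the source.
* §7 **irreducibility on the `W`-side**: `HasCommonRatZero P` (the two conics of `P` have a common
  rational zero — the pairs excluded from the irreducible-orbit counts of [dodqf]), its invariance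
  on orbits (`hasCommonRatZero_iff_of_gEquiv`), and `not_hasCommonRatZero_ofQuartic`: for
  irreducible `f` the conics `A₁`, `B_f` have no common rational zero (a rational point of the
  Veronese conic is a Veronese point, where `B_f` restricts to `f`).

No named facts are introduced; Thm 2.19 and the Delone–Evertse theorem are *not* asserted here.

## References

* M. Bhargava, A. Shankar, Ann. of Math. (2) 181 (2015) 191–242, §2.6 of the published version
  (strong/weak divisibility, `W_p^{(1)}, W_p^{(2)}`, eq. (28), Prop. 2.16, Thm 2.19 and the display
  following it). [cite: BhargavaShankarAnnals2015, §2.6 (Thm 2.19 and the estimate N(W_p^{(2)}(V);X) = O(X/p²); published numbering)]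
* M. Bhargava, *The density of discriminants of quartic rings and fields*, Ann. of Math. (2) 162
  (2005) 1031–1063, Prop. 23 (cited through the source as [dodqf]; not used here).
* B. N. Delone (1930), J.-H. Evertse (1983) on cubic Thue equations `g(x, y) = 1` (cited through
  the source as [Del], [Ev]; not used here).
-/

noncomputable section

open Matrix

namespace Literature.NumberTheory.EllipticCurves

/-! ### An elementary counting lemma -/

/-- If the fibres of `F` on a finite set `s` have at most `n` elements then `#s ≤ n · #F(s)`
(`Finset.card_le_mul_card_image` for `Set.ncard`). [folklore] -/
theorem Set.ncard_le_mul_ncard_image_of_fibre_le {α β : Type*} {s : Set α} (hs : s.Finite)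
    (F : α → β) {n : ℕ} (h : ∀ a ∈ s, {a' ∈ s | F a' = F a}.ncard ≤ n) :
    s.ncard ≤ n * (F '' s).ncard := by
  classical
  lift s to Finset α using hs
  rw [Set.ncard_coe_finset, ← Finset.coe_image, Set.ncard_coe_finset]
  refine Finset.card_le_mul_card_image s n fun b hb ↦ ?_
  obtain ⟨a, ha, rfl⟩ := Finset.mem_image.mp hb
  have := h a (Finset.mem_coe.mpr ha)
  rw [← Set.ncard_coe_finset, Finset.coe_filter]
  exact this

namespace TernaryPairs

/-! ### §1. The orbit relation of `GL₂(ℤ) × SL₃(ℤ)` on `W_ℤ` -/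

/-- `P ~ P'` under `GL₂(ℤ) × SL₃(ℤ)`: `P' = (γ₂, γ₃) · P` with `det γ₂ = ±1`, `det γ₃ = 1`
(Bhargava–Shankar, published §2.6: "`(GL₂(ℤ) × SL₃(ℤ))`-orbits on `W_ℤ`"; held arXiv text §3.3
p. 15). [cite: BhargavaShankarAnnals2015, §3.3 p. 15 (GL₂ × SL₃-orbits on W; arXiv:1006.1002v2 numbering)] -/
def GEquiv (P P' : Pair) : Prop :=
  ∃ γ₂ : Matrix (Fin 2) (Fin 2) ℤ, ∃ γ₃ : Matrix (Fin 3) (Fin 3) ℤ,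
    IsUnit γ₂.det ∧ γ₃.det = 1 ∧ P' = act γ₂ γ₃ P

/-- `GEquiv` is reflexive. [folklore] -/
theorem GEquiv.refl (P : Pair) : GEquiv P P :=
  ⟨1, 1, by simp, Matrix.det_one, (act_one_one P).symm⟩

/-- `GEquiv` is transitive. [folklore] -/
theorem GEquiv.trans {P P' P'' : Pair} (h : GEquiv P P') (h' : GEquiv P' P'') : GEquiv P P'' := by
  obtain ⟨γ₂, γ₃, h₂, h₃, rfl⟩ := h
  obtain ⟨γ₂', γ₃', h₂', h₃', rfl⟩ := h'
  refine ⟨γ₂' * γ₂, γ₃' * γ₃, ?_, ?_, (act_mul_mul γ₂' γ₂ γ₃' γ₃ P).symm⟩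
  · rw [Matrix.det_mul]; exact h₂'.mul h₂
  · rw [Matrix.det_mul, h₃, h₃', one_mul]

/-- `GEquiv` is symmetric (inverses of unimodular integral matrices are integral). [folklore] -/
theorem GEquiv.symm {P P' : Pair} (h : GEquiv P P') : GEquiv P' P := by
  obtain ⟨γ₂, γ₃, h₂, h₃, rfl⟩ := h
  have h₃u : IsUnit γ₃.det := by rw [h₃]; exact isUnit_one
  refine ⟨γ₂⁻¹, γ₃⁻¹, Matrix.isUnit_nonsing_inv_det_iff.mpr h₂, ?_, ?_⟩
  · rw [Matrix.det_nonsing_inv, h₃, Ring.inverse_one]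
  · rw [← act_mul_mul, Matrix.nonsing_inv_mul γ₂ h₂, Matrix.nonsing_inv_mul γ₃ h₃u, act_one_one]

/-- `GEquiv` is an equivalence relation. [folklore] -/
theorem GEquiv.equivalence : Equivalence GEquiv :=
  ⟨GEquiv.refl, GEquiv.symm, GEquiv.trans⟩

/-- The `GL₂(ℤ) × SL₃(ℤ)`-orbit of `P ∈ W_ℤ`. [folklore] -/
def gOrbit (P : Pair) : Set Pair :=
  {P' | GEquiv P P'}

/-- `P` lies in its own orbit. [folklore] -/
theorem mem_gOrbit_self (P : Pair) : P ∈ gOrbit P :=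
  GEquiv.refl P

/-- Equivalent pairs have the same orbit. [folklore] -/
theorem gOrbit_eq_of_gEquiv {P P' : Pair} (h : GEquiv P P') : gOrbit P' = gOrbit P := by
  ext Q
  exact ⟨fun hQ ↦ h.trans hQ, fun hQ ↦ h.symm.trans hQ⟩

/-- Orbits are equal iff the pairs are equivalent. [folklore] -/
theorem gOrbit_eq_iff {P P' : Pair} : gOrbit P = gOrbit P' ↔ GEquiv P P' := by
  refine ⟨fun h ↦ ?_, fun h ↦ (gOrbit_eq_of_gEquiv h).symm⟩
  have : P' ∈ gOrbit P := by rw [h]; exact mem_gOrbit_self P'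
  exact this

/-! ### §2. `φ(f) = (2A₁, 2B_f)` and the induced map on classes -/

/-- `φ(f) = (A₁, B_f) ∈ W_ℤ`, doubled: `(2A₁, 2B_f)` (Bhargava–Shankar, published eq. (26) and
(28); held arXiv text §3.3 p. 15). [cite: BhargavaShankarAnnals2015, §3.3 p. 15 (the map φ; arXiv:1006.1002v2 numbering)] -/
def ofQuartic (f : BinaryQuartic ℤ) : Pair :=
  (twoA1, BinaryQuartic.gram f)

/-- First component of `φ(f)`. [folklore] -/
@[simp] theorem ofQuartic_fst (f : BinaryQuartic ℤ) : (ofQuartic f).1 = twoA1 := rfl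

/-- Second component of `φ(f)`. [folklore] -/
@[simp] theorem ofQuartic_snd (f : BinaryQuartic ℤ) : (ofQuartic f).2 = BinaryQuartic.gram f := rfl

/-- The fibre of `ψ` over `[P]` (from `BinaryQuarticResolventFibres`) consists of the `2B_f` with
`φ(f) ~ P`. [folklore] -/
theorem mem_fibre_iff (P : Pair) (B : Matrix (Fin 3) (Fin 3) ℤ) :
    B ∈ fibre P ↔ GEquiv P (twoA1, B) :=
  Iff.rfl

/-- `F_{ℤ,1} × SO(A₁, ℤ)`-equivalent elements of `W_{ℤ,1}` are `GL₂(ℤ) × SL₃(ℤ)`-equivalent: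
`σ B σᵀ + u(2A₁)` is the second component of `((1 0; u 1), σ) · (2A₁, B)`. [folklore] -/
theorem gEquiv_of_w1Equiv {B B' : Matrix (Fin 3) (Fin 3) ℤ} (h : W1Equiv B B') :
    GEquiv ((twoA1, B) : Pair) (twoA1, B') := by
  obtain ⟨σ, hσ, u, rfl⟩ := h
  have e00 : (!![1, 0; u, 1] : Matrix (Fin 2) (Fin 2) ℤ) 0 0 = 1 := rfl
  have e01 : (!![1, 0; u, 1] : Matrix (Fin 2) (Fin 2) ℤ) 0 1 = 0 := rfl
  have e10 : (!![1, 0; u, 1] : Matrix (Fin 2) (Fin 2) ℤ) 1 0 = u := rfl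
  have e11 : (!![1, 0; u, 1] : Matrix (Fin 2) (Fin 2) ℤ) 1 1 = 1 := rfl
  refine ⟨!![1, 0; u, 1], σ, ?_, hσ.1, ?_⟩
  · rw [Matrix.det_fin_two, e00, e01, e10, e11]; simp
  · show ((twoA1, σ * B * σᵀ + u • twoA1) : Pair) = act !![1, 0; u, 1] σ (twoA1, B)
    simp only [act, e00, e01, e10, e11]
    rw [conj_add_smul, conj_add_smul, hσ.2]
    simp only [one_smul, zero_smul, add_zero]
    exact Prod.ext rfl (add_comm _ _)

/-- **`ψ : PGL₂(ℤ)\V_ℤ → (GL₂(ℤ) × SL₃(ℤ))\W_ℤ` is well defined** (Bhargava–Shankar, published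
eq. (28): the composite of Thm 2.14 with `(F_{ℤ,1} × SO(A₁, ℤ))\W_{ℤ,1} → (GL₂(ℤ) × SL₃(ℤ))\W_ℤ`):
`GL₂(ℤ)`-equivalent forms have `GL₂(ℤ) × SL₃(ℤ)`-equivalent images.
[cite: BhargavaShankarAnnals2015, §3.3 p. 16 (arXiv:1006.1002v2); eq. (28) of the published version] -/
theorem gEquiv_ofQuartic_of_gl2zEquiv {f f' : BinaryQuartic ℤ} (h : BinaryQuartic.GL2ZEquiv f f') :
    GEquiv (ofQuartic f) (ofQuartic f') :=
  gEquiv_of_w1Equiv ((BinaryQuartic.w1Equiv_gram_iff f f').mpr h)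

/-! ### §3. The fibre-sum inequality (Prop. 2.16 summed over the image of `ψ`) -/

/-- **Fibre-sum inequality.** Let `S ⊆ V_ℤ` and suppose that for every `f ∈ S` the solutions of
`g_{φ(f)}(x, y) = 1` (doubled: `twoRes (φ f) x y = 2`) lie in a set of at most `D` pairs. Then the
number of `GL₂(ℤ)`-orbits met by `S` is at most `2·D` times the number of
`GL₂(ℤ) × SL₃(ℤ)`-orbits met by `φ(S)`: each fibre of `ψ` has at most `2·D` elements
(`ncard_gl2zOrbits_fibre_le`, the mechanism of Prop. 2.16 of the published version).
[cite: BhargavaShankarAnnals2015, §3.3 p. 16 (arXiv:1006.1002v2); Prop. 2.16 of the published version (summed over the image)] -/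
theorem ncard_gl2zOrbits_le (S : Set (BinaryQuartic ℤ)) (D : ℕ)
    (hD : ∀ f ∈ S, ∃ T : Finset (ℤ × ℤ), T.card ≤ D ∧
      ∀ x y : ℤ, twoRes (ofQuartic f) x y = 2 → (x, y) ∈ T) :
    (BinaryQuartic.gl2zOrbit '' S).ncard ≤ 2 * D * ((fun f ↦ gOrbit (ofQuartic f)) '' S).ncard := by
  classical
  rcases (BinaryQuartic.gl2zOrbit '' S).finite_or_infinite with hfin | hinf
  swap
  · rw [hinf.ncard]; exact Nat.zero_le _
  -- the class map `Ψ : GL₂(ℤ)f ↦ (GL₂(ℤ) × SL₃(ℤ))φ(f)`, written choice-free on orbits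
  set Ψ : Set (BinaryQuartic ℤ) → Set Pair := fun O ↦ {Q | ∃ f ∈ O, GEquiv (ofQuartic f) Q} with hΨdef
  have hΨ : ∀ f₀ : BinaryQuartic ℤ, Ψ (BinaryQuartic.gl2zOrbit f₀) = gOrbit (ofQuartic f₀) := by
    intro f₀
    ext Q
    simp only [hΨdef, Set.mem_setOf_eq, gOrbit, BinaryQuartic.gl2zOrbit]
    constructor
    · rintro ⟨f, hf, h⟩
      exact (gEquiv_ofQuartic_of_gl2zEquiv hf).trans h
    · intro h
      exact ⟨f₀, BinaryQuartic.GL2ZEquiv.refl f₀, h⟩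
  have himage : Ψ '' (BinaryQuartic.gl2zOrbit '' S) = (fun f ↦ gOrbit (ofQuartic f)) '' S := by
    rw [Set.image_image]
    exact Set.image_congr fun f _ ↦ hΨ f
  rw [← himage]
  refine Set.ncard_le_mul_ncard_image_of_fibre_le hfin Ψ fun O hO ↦ ?_
  obtain ⟨f₀, hf₀, rfl⟩ := hO
  obtain ⟨T, hTD, hT⟩ := hD f₀ hf₀
  -- the auxiliary map to `F_{ℤ,1} × SO(A₁, ℤ)`-classes (Thm 2.14)
  let Φ : Set (BinaryQuartic ℤ) → Set (Matrix (Fin 3) (Fin 3) ℤ) := fun O ↦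
    {B'' | ∃ f ∈ O, W1Equiv (BinaryQuartic.gram f) B''}
  have hΦ : ∀ f : BinaryQuartic ℤ,
      Φ (BinaryQuartic.gl2zOrbit f) = w1Class (BinaryQuartic.gram f) := by
    intro f
    ext B''
    simp only [Φ, Set.mem_setOf_eq, w1Class]
    constructor
    · rintro ⟨f', hf', h⟩
      exact ((BinaryQuartic.w1Equiv_gram_iff f f').mpr hf').trans h
    · intro h
      exact ⟨f, BinaryQuartic.GL2ZEquiv.refl f, h⟩
  calc {O ∈ BinaryQuartic.gl2zOrbit '' S | Ψ O = Ψ (BinaryQuartic.gl2zOrbit f₀)}.ncard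
      ≤ (w1Class '' fibre (ofQuartic f₀)).ncard := by
        refine Set.ncard_le_ncard_of_injOn Φ ?_ ?_ (finite_classes_fibre (ofQuartic f₀) T hT)
        · rintro O ⟨⟨f, -, rfl⟩, hO⟩
          rw [hΨ, hΨ, gOrbit_eq_iff] at hO
          exact ⟨BinaryQuartic.gram f, (mem_fibre_iff _ _).mpr hO.symm, (hΦ f).symm⟩
        · rintro O ⟨⟨f, -, rfl⟩, -⟩ O' ⟨⟨f', -, rfl⟩, -⟩ h
          rw [hΦ, hΦ] at h
          have h01 : W1Equiv (BinaryQuartic.gram f) (BinaryQuartic.gram f') := by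
            have : BinaryQuartic.gram f' ∈ w1Class (BinaryQuartic.gram f') := W1Equiv.refl _
            rw [← h] at this
            exact this
          have hequiv := (BinaryQuartic.w1Equiv_gram_iff f f').mp h01
          ext g
          exact ⟨fun hg ↦ hequiv.symm.trans hg, fun hg ↦ hequiv.trans hg⟩
    _ ≤ 2 * T.card := ncard_classes_fibre_le (ofQuartic f₀) T hT
    _ ≤ 2 * D := Nat.mul_le_mul_left 2 hTD

/-! ### §4. The discriminant of a pair of ternary quadratic forms -/

/-- The mixed term `∑ᵢ Det(M with row i replaced by row i of N)` of `Det(xM − yN)`. [folklore] -/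
def mixedDet (M N : Matrix (Fin 3) (Fin 3) ℤ) : ℤ :=
  (Matrix.of ![N 0, M 1, M 2]).det + (Matrix.of ![M 0, N 1, M 2]).det
    + (Matrix.of ![M 0, M 1, N 2]).det

/-- **The doubled resolvent cubic form of `P = (P₁, P₂) ∈ W_ℤ` as a `Cubic`**: the coefficients
of `Det(x·P₁ − y·P₂) = Det(P₁)x³ − (…)x²y + (…)xy² − Det(P₂)y³` (`twoRes_eq_cubicForm`); for
`P = (2A, 2B)` this is `8·Det(Ax − By) = 2·g(x, y)`, `g = 4·Det(Ax − By)` the resolvent cubic form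
of the source (published §2.6; held arXiv text §3.3 p. 15).
[cite: BhargavaShankarAnnals2015, §3.3 p. 15 (g = 4 det(AX − BY); arXiv:1006.1002v2 numbering)] -/
def twoResCubic (P : Pair) : Cubic ℤ :=
  ⟨P.1.det, -mixedDet P.1 P.2, mixedDet P.2 P.1, -P.2.det⟩

/-- The binary cubic form `a x³ + b x²y + c xy² + d y³` of a `Cubic` `⟨a, b, c, d⟩`. [folklore] -/
def cubicForm (C : Cubic ℤ) (x y : ℤ) : ℤ :=
  C.a * x ^ 3 + C.b * x ^ 2 * y + C.c * x * y ^ 2 + C.d * y ^ 3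

/-- `Det(x·P₁ − y·P₂)` is the binary cubic form with coefficients `twoResCubic P`. [folklore] -/
theorem twoRes_eq_cubicForm (P : Pair) (x y : ℤ) :
    twoRes P x y = cubicForm (twoResCubic P) x y := by
  simp only [twoRes, cubicForm, twoResCubic, mixedDet, Matrix.det_fin_three, Matrix.sub_apply,
    Matrix.smul_apply, smul_eq_mul, Matrix.of_apply, Matrix.cons_val_zero, Matrix.cons_val_one,
    Matrix.cons_val_two, Matrix.head_cons, Matrix.tail_cons]
  ring

/-- A binary cubic form over `ℤ` determines its coefficients. [folklore] -/
theorem cubic_eq_of_cubicForm_eq {C C' : Cubic ℤ} (h : ∀ x y : ℤ, cubicForm C x y = cubicForm C' x y) :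
    C = C' := by
  obtain ⟨a, b, c, d⟩ := C
  obtain ⟨a', b', c', d'⟩ := C'
  have h1 := h 1 0
  have h2 := h 0 1
  have h3 := h 1 1
  have h4 := h 1 (-1)
  simp only [cubicForm] at h1 h2 h3 h4
  norm_num at h1 h2 h3 h4
  simp only [Cubic.mk.injEq]
  omega

/-- `twoResCubic (φ f) = (2, 2c, 2(bd − 4ae), 2(ad² + b²e − 4ace))`, twice the resolvent cubic
`g_f` of `BinaryQuarticResolventEmbedding` (held arXiv text §3.3 p. 16: "we compute `g` to be
`X³ + cX²Y + (bd − 4ae)XY² + (ad² + b²e − 4ace)Y³`"). [cite: BhargavaShankarAnnals2015, §3.3 p. 16 (resolvent cubic form g; arXiv:1006.1002v2 numbering)] -/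
theorem twoResCubic_ofQuartic (f : BinaryQuartic ℤ) :
    twoResCubic (ofQuartic f) = ⟨2, 2 * f.c, 2 * (f.b * f.d - 4 * f.a * f.e),
      2 * (f.a * f.d ^ 2 + f.b ^ 2 * f.e - 4 * f.a * f.c * f.e)⟩ := by
  refine cubic_eq_of_cubicForm_eq fun x y ↦ ?_
  rw [← twoRes_eq_cubicForm, ofQuartic, twoRes_gram]
  simp only [cubicForm]
  ring

/-- `Disc(2 g_f) = 16 Δ(f)` ("φ is discriminant preserving", up to the doubling).
[cite: BhargavaShankarAnnals2015, §3.3 p. 16 (arXiv:1006.1002v2); §2.6 of the published version (φ is discriminant preserving)] -/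
theorem discr_twoResCubic_ofQuartic (f : BinaryQuartic ℤ) : (twoResCubic (ofQuartic f)).discr = 16 * f.disc := by
  rw [twoResCubic_ofQuartic, ← BinaryQuartic.discr_resolventCubic]
  simp only [Cubic.discr, BinaryQuartic.resolventCubic]
  ring

/-- **The discriminant of `P = (2A, 2B) ∈ W_ℤ`**: `Disc(A, B) := Disc(4·Det(Ax − By))`, the
discriminant of the resolvent binary cubic form, computed in doubled coordinates as
`Disc(Det(x·2A − y·2B))/16 = Disc(2g)/16 = Disc(g)` (exact on `W_ℤ`, where `Det(x·2A − y·2B) = 2g`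
has even coefficients). [cite: BhargavaShankarAnnals2015, §2.6 of the published version (discriminant on W_ℤ via the cubic resolvent form 4·Det(Ax − By))] -/
def disc (P : Pair) : ℤ :=
  (twoResCubic P).discr / 16

/-- **`φ` is discriminant preserving**: `disc (φ f) = Δ(f)` (Bhargava–Shankar, published §2.6:
"the map `φ` is discriminant preserving, i.e., the discriminant of an element of `V_ℤ` is equal to
the discriminant of its image in `W_ℤ`"). [cite: BhargavaShankarAnnals2015, §2.6 of the published version (φ is discriminant preserving); §3.3 p. 16 of arXiv:1006.1002v2] -/
theorem disc_ofQuartic (f : BinaryQuartic ℤ) : disc (ofQuartic f) = f.disc := by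
  rw [disc, discr_twoResCubic_ofQuartic, Int.mul_ediv_cancel_left _ (by norm_num : (16 : ℤ) ≠ 0)]

/-- The cubic `u · C(px − ry, −qx + sy)` (coefficients of a scaled linear substitution).
[folklore] -/
def substCubic (C : Cubic ℤ) (u p q r s : ℤ) : Cubic ℤ :=
  ⟨u * (C.a * p ^ 3 - C.b * p ^ 2 * q + C.c * p * q ^ 2 - C.d * q ^ 3),
    u * (-3 * C.a * p ^ 2 * r + C.b * (p ^ 2 * s + 2 * p * q * r) - C.c * (2 * p * q * s + q ^ 2 * r)
      + 3 * C.d * q ^ 2 * s),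
    u * (3 * C.a * p * r ^ 2 - C.b * (2 * p * r * s + q * r ^ 2) + C.c * (p * s ^ 2 + 2 * q * r * s)
      - 3 * C.d * q * s ^ 2),
    u * (-C.a * r ^ 3 + C.b * r ^ 2 * s - C.c * r * s ^ 2 + C.d * s ^ 3)⟩

/-- `substCubic` is the substituted form: `(substCubic C u p q r s)(x, y) = u·C(xp − yr, −xq + ys)`.
[folklore] -/
theorem cubicForm_substCubic (C : Cubic ℤ) (u p q r s x y : ℤ) :
    cubicForm (substCubic C u p q r s) x y = u * cubicForm C (x * p - y * r) (-(x * q) + y * s) := by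
  simp only [cubicForm, substCubic]
  ring

/-- **Covariance of the cubic discriminant**: `Disc(u · C∘γ) = u⁴ (det γ)⁶ Disc(C)`. [folklore] -/
theorem discr_substCubic (C : Cubic ℤ) (u p q r s : ℤ) :
    (substCubic C u p q r s).discr = u ^ 4 * (p * s - q * r) ^ 6 * C.discr := by
  simp only [Cubic.discr, substCubic]
  ring

/-- The resolvent cubic of `(γ₂, γ₃) · P` is `(det γ₃)² · g_P` composed with the substitution by
`γ₂ = (p q; r s)` (coefficient form of `twoRes_act`). [cite: BhargavaShankarAnnals2015, §3.3 p. 15 (SL₃ fixes the resolvent cubic form; arXiv:1006.1002v2 numbering)] -/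
theorem twoResCubic_act (γ₂ : Matrix (Fin 2) (Fin 2) ℤ) (γ₃ : Matrix (Fin 3) (Fin 3) ℤ) (P : Pair) :
    twoResCubic (act γ₂ γ₃ P) =
      substCubic (twoResCubic P) (γ₃.det ^ 2) (γ₂ 0 0) (γ₂ 0 1) (γ₂ 1 0) (γ₂ 1 1) := by
  refine cubic_eq_of_cubicForm_eq fun x y ↦ ?_
  rw [← twoRes_eq_cubicForm, twoRes_act, twoRes_eq_cubicForm, cubicForm_substCubic]

/-- `Disc(twoResCubic ((γ₂, γ₃) · P)) = (det γ₃)⁸ (det γ₂)⁶ Disc(twoResCubic P)`. [folklore] -/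
theorem discr_twoResCubic_act (γ₂ : Matrix (Fin 2) (Fin 2) ℤ) (γ₃ : Matrix (Fin 3) (Fin 3) ℤ)
    (P : Pair) :
    (twoResCubic (act γ₂ γ₃ P)).discr = γ₃.det ^ 8 * γ₂.det ^ 6 * (twoResCubic P).discr := by
  rw [twoResCubic_act, discr_substCubic, Matrix.det_fin_two]
  ring

/-- **The discriminant on `W_ℤ` is `GL₂(ℤ) × SL₃^{±}(ℤ)`-invariant.** [cite: BhargavaShankarAnnals2015, §2.6 of the published version (orbits on W_ℤ "having discriminant bounded by X")] -/
theorem disc_act {γ₂ : Matrix (Fin 2) (Fin 2) ℤ} {γ₃ : Matrix (Fin 3) (Fin 3) ℤ}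
    (h₂ : IsUnit γ₂.det) (h₃ : IsUnit γ₃.det) (P : Pair) : disc (act γ₂ γ₃ P) = disc P := by
  have h2 : γ₂.det ^ 6 = 1 := by
    rcases Int.isUnit_iff.mp h₂ with h | h <;> rw [h] <;> norm_num
  have h3 : γ₃.det ^ 8 = 1 := by
    rcases Int.isUnit_iff.mp h₃ with h | h <;> rw [h] <;> norm_num
  rw [disc, disc, discr_twoResCubic_act, h2, h3, one_mul, one_mul]

/-- Equivalent pairs have the same discriminant. [folklore] -/
theorem disc_eq_of_gEquiv {P P' : Pair} (h : GEquiv P P') : disc P' = disc P := by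
  obtain ⟨γ₂, γ₃, h₂, h₃, rfl⟩ := h
  exact disc_act h₂ (by rw [h₃]; exact isUnit_one) P

/-! ### §5. Strong divisibility by `p²` on `W_ℤ` and on `V_ℤ`; the transport `φ(W_p^{(2)}(V)) ⊆ W_p^{(2)}(W)` -/

/-- **Strong divisibility on `W_ℤ`**: "the discriminant of `w ∈ W_ℤ` is *strongly divisible* by
`p²` if `p² ∣ Δ(w + pw')` for all `w' ∈ W_ℤ`" (Bhargava–Shankar, published §2.6), for doubled pairs
(`W_ℤ` = pairs of doubled integral Gram matrices, `IsEvenSymm`).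
[cite: BhargavaShankarAnnals2015, §2.6 of the published version (strong divisibility by p² on W_ℤ)] -/
def IsStronglySqDvd (p : ℤ) (P : Pair) : Prop :=
  ∀ P' : Pair, IsEvenSymm P'.1 → IsEvenSymm P'.2 → p ^ 2 ∣ disc (P + p • P')

/-- **`W_p^{(2)}(W)`**: "the set of elements in `W_ℤ` whose discriminants are divisible, but not
strongly divisible, by `p²`" (Bhargava–Shankar, published Thm 2.19), for doubled pairs.
[cite: BhargavaShankarAnnals2015, Thm 2.19 of the published version (the set W_p^{(2)}(W))] -/
def weaklySqDvd (p : ℤ) : Set Pair :=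
  {P | IsEvenSymm P.1 ∧ IsEvenSymm P.2 ∧ p ^ 2 ∣ disc P ∧ ¬ IsStronglySqDvd p P}

/-- The action is `ℤ`-linear in the pair: `(γ₂, γ₃) · (P + cQ) = (γ₂, γ₃) · P + c (γ₂, γ₃) · Q`.
[folklore] -/
theorem act_add_smul (γ₂ : Matrix (Fin 2) (Fin 2) ℤ) (γ₃ : Matrix (Fin 3) (Fin 3) ℤ) (P Q : Pair)
    (c : ℤ) : act γ₂ γ₃ (P + c • Q) = act γ₂ γ₃ P + c • act γ₂ γ₃ Q := by
  simp only [act, Prod.fst_add, Prod.snd_add, Prod.smul_fst, Prod.smul_snd, Prod.smul_mk,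
    Prod.mk_add_mk, Prod.mk.injEq, smul_add, Matrix.mul_add, Matrix.add_mul, Matrix.mul_smul,
    Matrix.smul_mul]
  constructor <;> module

/-- The action preserves `W_ℤ` (integrality of the ternary forms). [folklore] -/
theorem isEvenSymm_act (γ₂ : Matrix (Fin 2) (Fin 2) ℤ) (γ₃ : Matrix (Fin 3) (Fin 3) ℤ) {P : Pair}
    (h1 : IsEvenSymm P.1) (h2 : IsEvenSymm P.2) :
    IsEvenSymm (act γ₂ γ₃ P).1 ∧ IsEvenSymm (act γ₂ γ₃ P).2 :=
  ⟨((h1.smul _).add (h2.smul _)).conj γ₃, ((h1.smul _).add (h2.smul _)).conj γ₃⟩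

/-- Strong divisibility is transported along the action of `GL₂(ℤ) × SL₃^{±}(ℤ)`. [folklore] -/
theorem isStronglySqDvd_act {p : ℤ} {P : Pair} (h : IsStronglySqDvd p P)
    {γ₂ : Matrix (Fin 2) (Fin 2) ℤ} {γ₃ : Matrix (Fin 3) (Fin 3) ℤ}
    (h₂ : IsUnit γ₂.det) (h₃ : IsUnit γ₃.det) : IsStronglySqDvd p (act γ₂ γ₃ P) := by
  intro P' h1' h2'
  obtain ⟨hQ1, hQ2⟩ := isEvenSymm_act γ₂⁻¹ γ₃⁻¹ h1' h2'
  have hP' : P' = act γ₂ γ₃ (act γ₂⁻¹ γ₃⁻¹ P') := by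
    rw [← act_mul_mul, Matrix.mul_nonsing_inv γ₂ h₂, Matrix.mul_nonsing_inv γ₃ h₃, act_one_one]
  rw [hP', ← act_add_smul, disc_act h₂ h₃]
  exact h _ hQ1 hQ2

/-- **Strong divisibility is a property of `GL₂(ℤ) × SL₃(ℤ)`-orbits** (so that `W_p^{(1)}(W)`,
`W_p^{(2)}(W)` are unions of orbits, as the statement of Thm 2.19 presupposes).
[cite: BhargavaShankarAnnals2015, Thm 2.19 of the published version (orbits on W_p^{(2)}(W))] -/
theorem isStronglySqDvd_act_iff {p : ℤ} (P : Pair) {γ₂ : Matrix (Fin 2) (Fin 2) ℤ}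
    {γ₃ : Matrix (Fin 3) (Fin 3) ℤ} (h₂ : IsUnit γ₂.det) (h₃ : IsUnit γ₃.det) :
    IsStronglySqDvd p (act γ₂ γ₃ P) ↔ IsStronglySqDvd p P := by
  refine ⟨fun h ↦ ?_, fun h ↦ isStronglySqDvd_act h h₂ h₃⟩
  have := isStronglySqDvd_act h (Matrix.isUnit_nonsing_inv_det_iff.mpr h₂)
    (Matrix.isUnit_nonsing_inv_det_iff.mpr h₃)
  rwa [← act_mul_mul, Matrix.nonsing_inv_mul γ₂ h₂, Matrix.nonsing_inv_mul γ₃ h₃, act_one_one]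
    at this

/-- `W_p^{(2)}(W)` is a union of `GL₂(ℤ) × SL₃(ℤ)`-orbits. [cite: BhargavaShankarAnnals2015, Thm 2.19 of the published version (orbits on W_p^{(2)}(W))] -/
theorem mem_weaklySqDvd_of_gEquiv {p : ℤ} {P P' : Pair} (hP : P ∈ weaklySqDvd p)
    (h : GEquiv P P') : P' ∈ weaklySqDvd p := by
  obtain ⟨h1, h2, hd, hns⟩ := hP
  obtain ⟨γ₂, γ₃, h₂, h₃, rfl⟩ := h
  have h₃u : IsUnit γ₃.det := by rw [h₃]; exact isUnit_one
  obtain ⟨h1', h2'⟩ := isEvenSymm_act γ₂ γ₃ h1 h2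
  exact ⟨h1', h2', by rwa [disc_act h₂ h₃u], fun h ↦ hns ((isStronglySqDvd_act_iff P h₂ h₃u).mp h)⟩

/-- The orbit of an element of `W_p^{(2)}(W)` lies in `W_p^{(2)}(W)`. [folklore] -/
theorem gOrbit_subset_weaklySqDvd {p : ℤ} {P : Pair} (hP : P ∈ weaklySqDvd p) :
    gOrbit P ⊆ weaklySqDvd p :=
  fun _ h ↦ mem_weaklySqDvd_of_gEquiv hP h

/-- The zero matrix is a doubled integral Gram matrix. [folklore] -/
theorem isEvenSymm_zero : IsEvenSymm (0 : Matrix (Fin 3) (Fin 3) ℤ) :=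
  ⟨Matrix.isSymm_zero, fun i ↦ by simp⟩

/-- `φ` is affine: `φ(f) + p·(0, 2B_g) = φ(f + pg)`. [folklore] -/
theorem ofQuartic_add_smul (f g : BinaryQuartic ℤ) (p : ℤ) :
    ofQuartic f + p • ((0 : Matrix (Fin 3) (Fin 3) ℤ), BinaryQuartic.gram g) =
      ofQuartic ⟨f.a + p * g.a, f.b + p * g.b, f.c + p * g.c, f.d + p * g.d, f.e + p * g.e⟩ := by
  refine Prod.ext ?_ ?_
  · simp [ofQuartic]
  · ext i j
    fin_cases i <;> fin_cases j <;> simp [ofQuartic, BinaryQuartic.gram] <;> ring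

/-- **Strong divisibility of `φ(f)` in `W` forces strong divisibility of `f` in `V`**: testing
`p² ∣ Disc(φ(f) + p w')` on the perturbations `w' = (0, 2B_g)`, `g ∈ V_ℤ`, gives
`p² ∣ Δ(f + pg)` for all `g` (by `disc_ofQuartic`). [cite: BhargavaShankarAnnals2015, §2.6 of the published version (strong divisibility on V_ℤ and W_ℤ; φ discriminant preserving)] -/
theorem sq_dvd_disc_of_isStronglySqDvd_ofQuartic {p : ℤ} {f : BinaryQuartic ℤ}
    (h : IsStronglySqDvd p (ofQuartic f)) (g : BinaryQuartic ℤ) :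
    p ^ 2 ∣ (⟨f.a + p * g.a, f.b + p * g.b, f.c + p * g.c, f.d + p * g.d, f.e + p * g.e⟩ :
      BinaryQuartic ℤ).disc := by
  have := h (0, BinaryQuartic.gram g) isEvenSymm_zero (BinaryQuartic.isEvenSymm_gram g)
  rwa [ofQuartic_add_smul, disc_ofQuartic] at this

/-- In particular `p² ∣ Δ(a, b, c, d, e + pt)` for all `t` (the perturbations of the last
coefficient used in `BinaryQuarticDiscriminantLiftProofs` and the geometric sieve file). [folklore] -/
theorem sq_dvd_disc_add_e_of_isStronglySqDvd_ofQuartic {p : ℤ} {f : BinaryQuartic ℤ}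
    (h : IsStronglySqDvd p (ofQuartic f)) (t : ℤ) :
    p ^ 2 ∣ (⟨f.a, f.b, f.c, f.d, f.e + p * t⟩ : BinaryQuartic ℤ).disc := by
  simpa using sq_dvd_disc_of_isStronglySqDvd_ofQuartic h ⟨0, 0, 0, 0, t⟩

end TernaryPairs

namespace BinaryQuartic

open TernaryPairs

/-- **`W_p^{(2)}(V)`**: "the set of elements in `V_ℤ` having discriminant divisible, but not
strongly divisible, by `p²`", strong divisibility meaning `p² ∣ Δ(f + pg)` for all `g ∈ V_ℤ`
(Bhargava–Shankar, published §2.6). [cite: BhargavaShankarAnnals2015, §2.6 of the published version (the sets W_p^{(1)}(V), W_p^{(2)}(V))] -/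
def weaklySqDvd (p : ℤ) : Set (BinaryQuartic ℤ) :=
  {f | p ^ 2 ∣ f.disc ∧ ¬ ∀ g : BinaryQuartic ℤ, p ^ 2 ∣
    (⟨f.a + p * g.a, f.b + p * g.b, f.c + p * g.c, f.d + p * g.d, f.e + p * g.e⟩ :
      BinaryQuartic ℤ).disc}

/-- A form with `p² ∣ Δ(f)` some of whose `e`-perturbations `e + pt` have `p² ∤ Δ` lies in
`W_p^{(2)}(V)`. [folklore] -/
theorem mem_weaklySqDvd_of_not_forall_e {p : ℤ} {f : BinaryQuartic ℤ} (hΔ : p ^ 2 ∣ f.disc)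
    (hns : ¬ ∀ t : ℤ, p ^ 2 ∣ (⟨f.a, f.b, f.c, f.d, f.e + p * t⟩ : BinaryQuartic ℤ).disc) :
    f ∈ weaklySqDvd p := by
  refine ⟨hΔ, fun h ↦ hns fun t ↦ ?_⟩
  simpa using h ⟨0, 0, 0, 0, t⟩

/-- **`p² ∣ Δ(f)`, `p ∤ ∂Δ/∂e(f)` ⟹ `f ∈ W_p^{(2)}(V)`** (the dichotomy of the proof of Thm 2.20
of the published version: such `f` is not strongly divisible, by
`not_sq_dvd_disc_add_of_not_dvd_discDerivE`). [cite: BhargavaShankarAnnals2015, §2.6, proof of Thm 2.20 (published numbering)] -/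
theorem mem_weaklySqDvd_of_not_dvd_discDerivE {p : ℤ} (hp : Prime p) {f : BinaryQuartic ℤ}
    (hΔ : p ^ 2 ∣ f.disc) (hΔe : ¬ p ∣ f.discDerivE) : f ∈ weaklySqDvd p :=
  mem_weaklySqDvd_of_not_forall_e hΔ fun h ↦
    not_sq_dvd_disc_add_of_not_dvd_discDerivE f hp hΔ hΔe (h 1)

/-- **`φ(W_p^{(2)}(V)) ⊆ W_p^{(2)}(W)`**: the image of a form whose discriminant is divisible but
not strongly divisible by `p²` has the same property in `W_ℤ` (the step "we may use this
uniformity estimate for `W_p^{(2)}(W)` to obtain one for `W_p^{(2)}(V)`" of the source).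
[cite: BhargavaShankarAnnals2015, §2.6 of the published version (Thm 2.19 ⟹ N(W_p^{(2)}(V);X) = O(X/p²))] -/
theorem ofQuartic_mem_weaklySqDvd {p : ℤ} {f : BinaryQuartic ℤ} (hf : f ∈ weaklySqDvd p) :
    ofQuartic f ∈ TernaryPairs.weaklySqDvd p :=
  ⟨isEvenSymm_twoA1, isEvenSymm_gram f, by rw [disc_ofQuartic]; exact hf.1,
    fun h ↦ hf.2 (sq_dvd_disc_of_isStronglySqDvd_ofQuartic h)⟩

/-- The same from `p² ∣ Δ(f)`, `p ∤ ∂Δ/∂e(f)`. [cite: BhargavaShankarAnnals2015, §2.6, proof of Thm 2.20 (published numbering)] -/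
theorem ofQuartic_mem_weaklySqDvd_of_not_dvd_discDerivE {p : ℤ} (hp : Prime p) {f : BinaryQuartic ℤ}
    (hΔ : p ^ 2 ∣ f.disc) (hΔe : ¬ p ∣ f.discDerivE) : ofQuartic f ∈ TernaryPairs.weaklySqDvd p :=
  ofQuartic_mem_weaklySqDvd (mem_weaklySqDvd_of_not_dvd_discDerivE hp hΔ hΔe)

/-! ### §6. Assembly: `N(S; X) ≤ 2·D·#{orbits of φ(f)}`, and where these orbits lie -/

/-- **`|Δ(f)| ≤ 8 H(f)/27`**: from `27Δ = 4I³ − J²` and `H = max(|I|³, J²/4)` (so orbits of height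
`< X` have discriminant bounded by `8X/27 < X`). [cite: BhargavaShankarAnnals2015, §2 (H(f) = max(|I|³, J²/4), Δ = (4I³ − J²)/27)] -/
theorem abs_disc_le_height (f : BinaryQuartic ℤ) : (|f.disc| : ℝ) ≤ 8 / 27 * f.height := by
  have h27 : (27 : ℝ) * f.disc = 4 * (f.I : ℝ) ^ 3 - (f.J : ℝ) ^ 2 := by
    exact_mod_cast twentySeven_mul_disc f
  have hI : |(f.I : ℝ)| ^ 3 ≤ f.height := le_max_left _ _
  have hJ : (f.J : ℝ) ^ 2 / 4 ≤ f.height := le_max_right _ _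
  have hI' : |4 * (f.I : ℝ) ^ 3| ≤ 4 * f.height := by
    rw [abs_mul, abs_pow, abs_of_pos (by norm_num : (0 : ℝ) < 4)]
    linarith
  have hJ' : |(f.J : ℝ) ^ 2| ≤ 4 * f.height := by
    rw [abs_of_nonneg (sq_nonneg _)]
    linarith
  have key : 27 * |(f.disc : ℝ)| ≤ 8 * f.height := by
    rw [← abs_of_pos (by norm_num : (0 : ℝ) < 27), ← abs_mul, h27]
    exact (abs_sub _ _).trans (by linarith)
  linarith

/-- **`N(S; X) ≤ 2·D·#{(GL₂(ℤ) × SL₃(ℤ))·φ(f) : f ∈ S irreducible, H(f) < X}`** whenever every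
integral binary cubic form of nonzero discriminant represents `1` at most `D` times — the
transport of counting from `V_ℤ` to `W_ℤ` behind "in conjunction with Proposition 2.16, we obtain
the estimate `N(W_p^{(2)}(V); X) = O(X/p²)`" (Bhargava–Shankar, published §2.6; Prop. 2.16 invokes
the theorems of Delone and Evertse, `D = 12`). The resolvent cubic of an irreducible `f` has
discriminant `Δ(f) ≠ 0` (`disc_ne_zero_of_isIrreducible`).
[cite: BhargavaShankarAnnals2015, §2.6 of the published version (Prop. 2.16; Thm 2.19 ⟹ N(W_p^{(2)}(V);X) = O(X/p²))] -/
theorem gl2zClassCount_le_of_thue (S : Set (BinaryQuartic ℤ)) (X : ℝ) (D : ℕ)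
    (hD : ∀ C : Cubic ℤ, C.discr ≠ 0 →
      ∃ T : Finset (ℤ × ℤ), T.card ≤ D ∧ ∀ x y : ℤ, cubicForm C x y = 1 → (x, y) ∈ T) :
    gl2zClassCount S X ≤
      2 * D * ((fun f ↦ gOrbit (ofQuartic f)) '' {f | f ∈ S ∧ f.IsIrreducible ∧ f.height < X}).ncard := by
  unfold gl2zClassCount
  refine ncard_gl2zOrbits_le _ D fun f hf ↦ ?_
  obtain ⟨T, hTD, hT⟩ := hD (resolventCubic f)
    (by rw [discr_resolventCubic]; exact disc_ne_zero_of_isIrreducible hf.2.1)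
  refine ⟨T, hTD, fun x y hxy ↦ hT x y ?_⟩
  have h2 : twoRes (ofQuartic f) x y = 2 * cubicForm (resolventCubic f) x y := by
    rw [ofQuartic, twoRes_gram]
    simp only [cubicForm, resolventCubic]
    ring
  omega

/-- **Where the orbits lie**: for `f ∈ W_p^{(2)}(V)` irreducible with `H(f) < X`, the orbit of
`φ(f)` is an orbit on `W_p^{(2)}(W)` of nonzero discriminant bounded by `8X/27` — the orbits
counted by Thm 2.19 of the published version. [cite: BhargavaShankarAnnals2015, Thm 2.19 of the published version and the display following it] -/
theorem image_gOrbit_ofQuartic_weaklySqDvd_subset (p : ℤ) (X : ℝ) :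
    (fun f ↦ gOrbit (ofQuartic f)) '' {f | f ∈ weaklySqDvd p ∧ f.IsIrreducible ∧ f.height < X} ⊆
      gOrbit '' {P | P ∈ TernaryPairs.weaklySqDvd p ∧ TernaryPairs.disc P ≠ 0 ∧
        (|TernaryPairs.disc P| : ℝ) < 8 / 27 * X} := by
  rintro _ ⟨f, ⟨hW, hirr, hX⟩, rfl⟩
  refine ⟨ofQuartic f, ⟨ofQuartic_mem_weaklySqDvd hW, ?_, ?_⟩, rfl⟩
  · rw [disc_ofQuartic]; exact disc_ne_zero_of_isIrreducible hirr
  · rw [disc_ofQuartic]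
    exact (abs_disc_le_height f).trans_lt (by linarith)

/-- **Corollary (the shape of `N(W_p^{(2)}(V); X) = O(X/p²)`).** If every integral binary cubic
form of nonzero discriminant represents `1` at most `D` times, and the `GL₂(ℤ) × SL₃(ℤ)`-orbits on
`W_p^{(2)}(W)` of nonzero discriminant bounded by `8X/27` form a finite set of at most `B`
elements (the content of Thm 2.19 of the published version, with `B = C·X/p²`), then
`N(W_p^{(2)}(V); X) ≤ 2·D·B`. [cite: BhargavaShankarAnnals2015, §2.6 of the published version (Thm 2.19 and Prop. 2.16 ⟹ N(W_p^{(2)}(V);X) = O(X/p²))] -/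
theorem gl2zClassCount_weaklySqDvd_le (p : ℤ) (X : ℝ) (D B : ℕ)
    (hD : ∀ C : Cubic ℤ, C.discr ≠ 0 →
      ∃ T : Finset (ℤ × ℤ), T.card ≤ D ∧ ∀ x y : ℤ, cubicForm C x y = 1 → (x, y) ∈ T)
    (hfin : (gOrbit '' {P | P ∈ TernaryPairs.weaklySqDvd p ∧ TernaryPairs.disc P ≠ 0 ∧
        (|TernaryPairs.disc P| : ℝ) < 8 / 27 * X}).Finite)
    (hB : (gOrbit '' {P | P ∈ TernaryPairs.weaklySqDvd p ∧ TernaryPairs.disc P ≠ 0 ∧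
        (|TernaryPairs.disc P| : ℝ) < 8 / 27 * X}).ncard ≤ B) :
    gl2zClassCount (weaklySqDvd p) X ≤ 2 * D * B := by
  refine (gl2zClassCount_le_of_thue _ X D hD).trans (Nat.mul_le_mul_left _ ?_)
  exact (Set.ncard_le_ncard (image_gOrbit_ofQuartic_weaklySqDvd_subset p X) hfin).trans hB

end BinaryQuartic

/-! ### §7. The conics of `φ(f)` have no common rational zero (irreducible `f`) -/

namespace TernaryPairs

/-- The rational quadratic form `v ↦ v M vᵀ` of an integral (doubled) Gram matrix `M`. [folklore] -/
def qf (M : Matrix (Fin 3) (Fin 3) ℤ) (v : Fin 3 → ℚ) : ℚ :=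
  v ⬝ᵥ ((Int.castRingHom ℚ).mapMatrix M) *ᵥ v

/-- **The two conics of `P = (2A, 2B) ∈ W_ℤ` have a common rational zero**: a nonzero
`v ∈ ℚ³` with `A(v) = B(v) = 0` (the reducibility condition on pairs of ternary quadratic forms in
Bhargava's parametrization of quartic rings, [dodqf]; such pairs correspond to quartic rings that
are not integral domains). [cite: BhargavaShankarAnnals2015, §2.6 of the published version (Thm 2.19 = dodqf Prop. 23, counting orbits on W_ℤ)] -/
def HasCommonRatZero (P : Pair) : Prop :=
  ∃ v : Fin 3 → ℚ, v ≠ 0 ∧ qf P.1 v = 0 ∧ qf P.2 v = 0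

/-- `(2A₁)(v) = 2(v₀v₂ − v₁²)`: the Veronese conic. [folklore] -/
theorem qf_twoA1 (v : Fin 3 → ℚ) : qf twoA1 v = 2 * (v 0 * v 2 - v 1 ^ 2) := by
  simp [qf, twoA1, dotProduct, Matrix.mulVec, Fin.sum_univ_three, RingHom.mapMatrix_apply,
    Matrix.map_apply]
  ring

/-- `(2B_f)(v) = 2(a v₀² + b v₀v₁ + c v₁² + d v₁v₂ + e v₂²)`. [folklore] -/
theorem qf_gram (f : BinaryQuartic ℤ) (v : Fin 3 → ℚ) :
    qf (BinaryQuartic.gram f) v = 2 * (f.a * v 0 ^ 2 + f.b * v 0 * v 1 + f.c * v 1 ^ 2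
      + f.d * v 1 * v 2 + f.e * v 2 ^ 2) := by
  simp [qf, BinaryQuartic.gram, dotProduct, Matrix.mulVec, Fin.sum_univ_three,
    RingHom.mapMatrix_apply, Matrix.map_apply]
  ring

/-- **For irreducible `f`, the conics `A₁` and `B_f` have no common rational zero**: a rational
point of the Veronese conic `v₀v₂ = v₁²` is `(t², t, 1)·v₂` or `(v₀, 0, 0)`, where `B_f` takes the
values `v₂² f(t, 1)` and `v₀² a`, nonzero as `f` has no zero in `ℙ¹(ℚ)`
(`IsIrreducible.eval_ne_zero`). Hence `φ(f)` is an irreducible pair in the sense of [dodqf] for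
every irreducible `f` counted by `N(·; X)`. [cite: BhargavaShankarAnnals2015, §2.6 of the published version (ψ on classes of irreducible forms; Thm 2.19 = dodqf Prop. 23)] -/
theorem not_hasCommonRatZero_ofQuartic {f : BinaryQuartic ℤ} (hf : f.IsIrreducible) :
    ¬ HasCommonRatZero (ofQuartic f) := by
  rintro ⟨v, hv, h1, h2⟩
  rw [ofQuartic_fst, qf_twoA1] at h1
  rw [ofQuartic_snd, qf_gram] at h2
  have hcon : v 0 * v 2 = v 1 ^ 2 := by linarith
  have hB : (f.a : ℚ) * v 0 ^ 2 + f.b * v 0 * v 1 + f.c * v 1 ^ 2 + f.d * v 1 * v 2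
      + f.e * v 2 ^ 2 = 0 := by linarith
  by_cases h₂ : v 2 = 0
  · have h₁ : v 1 = 0 := by
      have : v 1 ^ 2 = 0 := by rw [← hcon, h₂, mul_zero]
      exact pow_eq_zero_iff (n := 2) (by norm_num) |>.mp this
    have h₀ : v 0 ≠ 0 := by
      intro h₀
      apply hv
      ext i
      fin_cases i <;> simp [h₀, h₁, h₂]
    have ha : (f.map (Int.castRingHom ℚ)).eval (v 0) 0 ≠ 0 :=
      hf.eval_ne_zero (Or.inl h₀)
    apply ha
    rw [BinaryQuartic.eval_zero_right]
    simp only [BinaryQuartic.map, eq_intCast]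
    have : (f.a : ℚ) * v 0 ^ 2 = 0 := by
      have := hB; rw [h₁, h₂] at this; linarith
    have ha0 : (f.a : ℚ) = 0 := by
      rcases mul_eq_zero.mp this with h | h
      · exact h
      · exact absurd (pow_eq_zero_iff (n := 2) (by norm_num) |>.mp h) h₀
    rw [ha0, zero_mul]
  · -- `v = v₂ · (t², t, 1)` with `t = v₁/v₂`, and `B_f(v) = v₂² f(t, 1)`
    set t : ℚ := v 1 / v 2 with ht
    have hv1 : v 1 = t * v 2 := by rw [ht, div_mul_cancel₀ _ h₂]
    have hv0 : v 0 = t ^ 2 * v 2 := by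
      have : v 0 * v 2 = (t ^ 2 * v 2) * v 2 := by rw [hcon, hv1]; ring
      exact mul_right_cancel₀ h₂ this
    have hft : (f.map (Int.castRingHom ℚ)).eval t 1 ≠ 0 := hf.eval_ne_zero (Or.inr one_ne_zero)
    apply hft
    have key : v 2 ^ 2 * (f.map (Int.castRingHom ℚ)).eval t 1 = 0 := by
      rw [← hB, hv0, hv1]
      simp only [BinaryQuartic.eval, BinaryQuartic.map, eq_intCast]
      ring
    rcases mul_eq_zero.mp key with h | h
    · exact absurd (pow_eq_zero_iff (n := 2) (by norm_num) |>.mp h) h₂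
    · exact h

/-- The value of the transformed ternary form: `(γ X γᵀ)(v) = X(vγ)` over `ℚ`. [folklore] -/
theorem qf_conj (γ X : Matrix (Fin 3) (Fin 3) ℤ) (v : Fin 3 → ℚ) :
    qf (γ * X * γᵀ) v = qf X (v ᵥ* (Int.castRingHom ℚ).mapMatrix γ) := by
  simp only [qf, map_mul, RingHom.mapMatrix_apply, Matrix.transpose_map]
  rw [← Matrix.mulVec_mulVec, ← Matrix.mulVec_mulVec, Matrix.dotProduct_mulVec,
    Matrix.mulVec_transpose]

/-- Linearity of `qf` in the matrix. [folklore] -/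
theorem qf_add_smul (a b : ℤ) (A B : Matrix (Fin 3) (Fin 3) ℤ) (v : Fin 3 → ℚ) :
    qf (a • A + b • B) v = a * qf A v + b * qf B v := by
  simp only [qf, map_add, map_zsmul]
  rw [Matrix.add_mulVec, Matrix.smul_mulVec, Matrix.smul_mulVec, dotProduct_add, dotProduct_smul,
    dotProduct_smul, zsmul_eq_mul, zsmul_eq_mul]

/-- A common rational zero is transported along the action: if `(γ₂, γ₃) · P` has one, so does `P`
(for `γ₂`, `γ₃` invertible). [folklore] -/
theorem HasCommonRatZero.of_act {P : Pair} {γ₂ : Matrix (Fin 2) (Fin 2) ℤ}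
    {γ₃ : Matrix (Fin 3) (Fin 3) ℤ} (h₂ : IsUnit γ₂.det) (h₃ : IsUnit γ₃.det)
    (h : HasCommonRatZero (TernaryPairs.act γ₂ γ₃ P)) : HasCommonRatZero P := by
  obtain ⟨v, hv, h1, h2⟩ := h
  set G : Matrix (Fin 3) (Fin 3) ℚ := (Int.castRingHom ℚ).mapMatrix γ₃ with hG
  set w : Fin 3 → ℚ := v ᵥ* G with hw
  simp only [TernaryPairs.act, qf_conj, qf_add_smul] at h1 h2
  rw [← hG, ← hw] at h1 h2
  -- invert `γ₂` on the pair of values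
  have hdet : (γ₂.det : ℚ) ≠ 0 := by
    rcases Int.isUnit_iff.mp h₂ with h | h <;> simp [h]
  have hA : qf P.1 w = 0 := by
    have key : (γ₂.det : ℚ) * qf P.1 w = 0 := by
      rw [Matrix.det_fin_two]; push_cast
      linear_combination (γ₂ 1 1 : ℚ) * h1 - (γ₂ 0 1 : ℚ) * h2
    exact (mul_eq_zero.mp key).resolve_left hdet
  have hB : qf P.2 w = 0 := by
    have key : (γ₂.det : ℚ) * qf P.2 w = 0 := by
      rw [Matrix.det_fin_two]; push_cast
      linear_combination (γ₂ 0 0 : ℚ) * h2 - (γ₂ 1 0 : ℚ) * h1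
    exact (mul_eq_zero.mp key).resolve_left hdet
  refine ⟨w, ?_, hA, hB⟩
  -- `w = vG ≠ 0` as `G` is invertible over `ℚ`
  have hGdet : G.det ≠ 0 := by
    rw [hG, ← RingHom.map_det]
    rcases Int.isUnit_iff.mp h₃ with h | h <;> simp [h]
  intro hw0
  apply hv
  have hGu : IsUnit G.det := isUnit_iff_ne_zero.mpr hGdet
  have : v = w ᵥ* G⁻¹ := by
    rw [hw, Matrix.vecMul_vecMul, Matrix.mul_nonsing_inv G hGu, Matrix.vecMul_one]
  rw [this, hw0, Matrix.zero_vecMul]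

/-- **Having a common rational zero is a property of `GL₂(ℤ) × SL₃(ℤ)`-orbits.** [folklore] -/
theorem hasCommonRatZero_iff_of_gEquiv {P P' : Pair} (h : GEquiv P P') :
    HasCommonRatZero P' ↔ HasCommonRatZero P := by
  obtain ⟨γ₂, γ₃, h₂, h₃, rfl⟩ := h
  have h₃u : IsUnit γ₃.det := by rw [h₃]; exact isUnit_one
  refine ⟨HasCommonRatZero.of_act h₂ h₃u, fun hP ↦ ?_⟩
  have hP' : P = TernaryPairs.act γ₂⁻¹ γ₃⁻¹ (TernaryPairs.act γ₂ γ₃ P) := by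
    rw [← act_mul_mul, Matrix.nonsing_inv_mul γ₂ h₂, Matrix.nonsing_inv_mul γ₃ h₃u, act_one_one]
  rw [hP'] at hP
  exact HasCommonRatZero.of_act (Matrix.isUnit_nonsing_inv_det_iff.mpr h₂)
    (Matrix.isUnit_nonsing_inv_det_iff.mpr h₃u) hP

/-- Hence every pair in the orbit of `φ(f)`, `f` irreducible, has conics without common rational
zero. [folklore] -/
theorem not_hasCommonRatZero_of_mem_gOrbit_ofQuartic {f : BinaryQuartic ℤ} (hf : f.IsIrreducible)
    {P : Pair} (hP : P ∈ gOrbit (ofQuartic f)) : ¬ HasCommonRatZero P := by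
  rw [hasCommonRatZero_iff_of_gEquiv hP]
  exact not_hasCommonRatZero_ofQuartic hf

end TernaryPairs

/-! ### Appendix: the refined orbit set (no common rational zero) and the Thue hypothesis from a cardinality bound -/

namespace BinaryQuartic

open TernaryPairs

/-- **Where the orbits lie (refined)**: for `f ∈ W_p^{(2)}(V)` irreducible with `H(f) < X`, the
orbit of `φ(f)` lies in `W_p^{(2)}(W)`, has discriminant `0 < |Disc| < 8X/27`, and consists of
pairs whose conics have **no common rational zero** (`not_hasCommonRatZero_ofQuartic`) — the
irreducible orbits counted by Thm 2.19 of the published version (= [dodqf, Prop. 23]).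
[cite: BhargavaShankarAnnals2015, Thm 2.19 of the published version and the display following it] -/
theorem image_gOrbit_ofQuartic_weaklySqDvd_subset_irred (p : ℤ) (X : ℝ) :
    (fun f ↦ gOrbit (ofQuartic f)) '' {f | f ∈ weaklySqDvd p ∧ f.IsIrreducible ∧ f.height < X} ⊆
      gOrbit '' {P | P ∈ TernaryPairs.weaklySqDvd p ∧ TernaryPairs.disc P ≠ 0 ∧
        (|TernaryPairs.disc P| : ℝ) < 8 / 27 * X ∧ ¬ HasCommonRatZero P} := by
  rintro _ ⟨f, ⟨hW, hirr, hX⟩, rfl⟩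
  refine ⟨ofQuartic f, ⟨ofQuartic_mem_weaklySqDvd hW, ?_, ?_, not_hasCommonRatZero_ofQuartic hirr⟩,
    rfl⟩
  · rw [disc_ofQuartic]; exact disc_ne_zero_of_isIrreducible hirr
  · rw [disc_ofQuartic]
    exact (abs_disc_le_height f).trans_lt (by linarith)

/-- **Corollary (refined shape of `N(W_p^{(2)}(V); X) = O(X/p²)`)**: as
`gl2zClassCount_weaklySqDvd_le`, with the orbit count restricted to pairs whose conics have no
common rational zero. [cite: BhargavaShankarAnnals2015, §2.6 of the published version (Thm 2.19 and Prop. 2.16 ⟹ N(W_p^{(2)}(V);X) = O(X/p²))] -/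
theorem gl2zClassCount_weaklySqDvd_le_irred (p : ℤ) (X : ℝ) (D B : ℕ)
    (hD : ∀ C : Cubic ℤ, C.discr ≠ 0 →
      ∃ T : Finset (ℤ × ℤ), T.card ≤ D ∧ ∀ x y : ℤ, cubicForm C x y = 1 → (x, y) ∈ T)
    (hfin : (gOrbit '' {P | P ∈ TernaryPairs.weaklySqDvd p ∧ TernaryPairs.disc P ≠ 0 ∧
        (|TernaryPairs.disc P| : ℝ) < 8 / 27 * X ∧ ¬ HasCommonRatZero P}).Finite)
    (hB : (gOrbit '' {P | P ∈ TernaryPairs.weaklySqDvd p ∧ TernaryPairs.disc P ≠ 0 ∧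
        (|TernaryPairs.disc P| : ℝ) < 8 / 27 * X ∧ ¬ HasCommonRatZero P}).ncard ≤ B) :
    gl2zClassCount (weaklySqDvd p) X ≤ 2 * D * B := by
  refine (gl2zClassCount_le_of_thue _ X D hD).trans (Nat.mul_le_mul_left _ ?_)
  exact (Set.ncard_le_ncard (image_gOrbit_ofQuartic_weaklySqDvd_subset_irred p X) hfin).trans hB

/-- The Thue hypothesis of `gl2zClassCount_le_of_thue` from a cardinality statement "the integral
solutions of `C(x, y) = 1` form a finite set of at most `D` elements for every integral binary
cubic form `C` of nonzero discriminant" (the form in which the theorems of Delone and Evertse,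
`D = 12`, are quoted in the proof of Prop. 2.16 of the published version). [cite: BhargavaShankarAnnals2015, §2.6, proof of Prop. 2.16 (published numbering; Delone–Evertse)] -/
theorem thue_hypothesis_of_ncard_le (D : ℕ)
    (h : ∀ C : Cubic ℤ, C.discr ≠ 0 →
      {v : ℤ × ℤ | cubicForm C v.1 v.2 = 1}.Finite ∧ {v : ℤ × ℤ | cubicForm C v.1 v.2 = 1}.ncard ≤ D) :
    ∀ C : Cubic ℤ, C.discr ≠ 0 →
      ∃ T : Finset (ℤ × ℤ), T.card ≤ D ∧ ∀ x y : ℤ, cubicForm C x y = 1 → (x, y) ∈ T := by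
  intro C hC
  obtain ⟨hfin, hcard⟩ := h C hC
  refine ⟨hfin.toFinset, ?_, fun x y hxy ↦ hfin.mem_toFinset.mpr hxy⟩
  rwa [← Set.ncard_eq_toFinset_card _ hfin]

end BinaryQuartic

/-! ### Appendix B: absolutely irreducible pairs ([dodqf, §2.2]) -/

namespace TernaryPairs

/-- The rational binary cubic form `a x³ + b x²y + c xy² + d y³` of a `Cubic ℤ`. [folklore] -/
def cubicFormQ (C : Cubic ℤ) (x y : ℚ) : ℚ :=
  (C.a : ℚ) * x ^ 3 + (C.b : ℚ) * x ^ 2 * y + (C.c : ℚ) * x * y ^ 2 + (C.d : ℚ) * y ^ 3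

/-- **Absolutely irreducible pairs** (M. Bhargava, *The density of discriminants of quartic rings
and fields*, Ann. of Math. 162 (2005), §2.2 p. 1037, the notion behind the counting function `N`
of [dodqf, Prop. 23] = Thm 2.19 of the source: "we call a pair `(A, B)` of integral ternary
quadratic forms in `V_ℤ` *absolutely irreducible* if • `A` and `B` do not possess a common zero as
conics in `ℙ²(ℚ)`; and • the binary cubic form `f(x, y) = Det(Ax − By)` is irreducible over `ℚ`"),
for doubled pairs. The second condition is stated as anisotropy of the (doubled) resolvent form
`Det(x·P₁ − y·P₂)` over `ℚ` — for a binary *cubic* form this is irreducibility over `ℚ` (a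
reducible cubic form has a linear factor, i.e. a zero in `ℙ¹(ℚ)`, and conversely by the factor
theorem; the zero form is neither). [cite: BhargavaShankarAnnals2015, Thm 2.19 of the published version (= dodqf Prop. 23; dodqf §2.2 p. 1037 for "absolutely irreducible")] -/
def IsAbsIrreducible (P : Pair) : Prop :=
  ¬ HasCommonRatZero P ∧ ∀ x y : ℚ, (x ≠ 0 ∨ y ≠ 0) → cubicFormQ (twoResCubic P) x y ≠ 0

/-- `cubicFormQ` extends `cubicForm`. [folklore] -/
theorem cubicFormQ_intCast (C : Cubic ℤ) (x y : ℤ) :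
    cubicFormQ C x y = (cubicForm C x y : ℚ) := by
  simp only [cubicFormQ, cubicForm]
  push_cast
  ring

/-- The substitution law of `substCubic` over `ℚ`. [folklore] -/
theorem cubicFormQ_substCubic (C : Cubic ℤ) (u p q r s : ℤ) (x y : ℚ) :
    cubicFormQ (substCubic C u p q r s) x y =
      u * cubicFormQ C (x * p - y * r) (-(x * q) + y * s) := by
  simp only [cubicFormQ, substCubic]
  push_cast
  ring

/-- Anisotropy of the resolvent form is transported along the action (the substitution by the
unimodular `γ₂` is invertible over `ℚ`). [folklore] -/
theorem resolvent_aniso_act {P : Pair} {γ₂ : Matrix (Fin 2) (Fin 2) ℤ}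
    {γ₃ : Matrix (Fin 3) (Fin 3) ℤ} (h₂ : IsUnit γ₂.det) (h₃ : IsUnit γ₃.det)
    (h : ∀ x y : ℚ, (x ≠ 0 ∨ y ≠ 0) → cubicFormQ (twoResCubic P) x y ≠ 0) :
    ∀ x y : ℚ, (x ≠ 0 ∨ y ≠ 0) → cubicFormQ (twoResCubic (act γ₂ γ₃ P)) x y ≠ 0 := by
  intro x y hxy hzero
  rw [twoResCubic_act, cubicFormQ_substCubic] at hzero
  have hu : ((γ₃.det ^ 2 : ℤ) : ℚ) ≠ 0 := by
    have : γ₃.det ≠ 0 := h₃.ne_zero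
    exact_mod_cast pow_ne_zero 2 this
  have hz := (mul_eq_zero.mp hzero).resolve_left hu
  refine h _ _ ?_ hz
  -- the new vector is nonzero as `det γ₂ ≠ 0`
  by_contra hboth
  simp only [not_or, not_not] at hboth
  obtain ⟨h1, h2⟩ := hboth
  have hdet : ((γ₂.det : ℤ) : ℚ) ≠ 0 := by exact_mod_cast h₂.ne_zero
  rw [Matrix.det_fin_two] at hdet
  push_cast at hdet
  have hx : x * ((γ₂ 0 0 : ℚ) * γ₂ 1 1 - γ₂ 0 1 * γ₂ 1 0) = 0 := by
    linear_combination (γ₂ 1 1 : ℚ) * h1 + (γ₂ 1 0 : ℚ) * h2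
  have hy : y * ((γ₂ 0 0 : ℚ) * γ₂ 1 1 - γ₂ 0 1 * γ₂ 1 0) = 0 := by
    linear_combination (γ₂ 0 1 : ℚ) * h1 + (γ₂ 0 0 : ℚ) * h2
  rcases hxy with hx0 | hy0
  · exact hx0 ((mul_eq_zero.mp hx).resolve_right hdet)
  · exact hy0 ((mul_eq_zero.mp hy).resolve_right hdet)

/-- **Absolute irreducibility is a property of `GL₂(ℤ) × SL₃(ℤ)`-orbits** (so that "the number of
absolutely irreducible orbits", dodqf's `N(·; X)`, is meaningful). [cite: BhargavaShankarAnnals2015, Thm 2.19 of the published version (= dodqf Prop. 23, counting absolutely irreducible orbits)] -/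
theorem isAbsIrreducible_iff_of_gEquiv {P P' : Pair} (h : GEquiv P P') :
    IsAbsIrreducible P' ↔ IsAbsIrreducible P := by
  have hC := hasCommonRatZero_iff_of_gEquiv h
  obtain ⟨γ₂, γ₃, h₂, h₃, rfl⟩ := h
  have h₃u : IsUnit γ₃.det := by rw [h₃]; exact isUnit_one
  refine ⟨fun ⟨hz, ha⟩ ↦ ⟨fun hc ↦ hz (hC.mpr hc), ?_⟩,
    fun ⟨hz, ha⟩ ↦ ⟨fun hc ↦ hz (hC.mp hc), resolvent_aniso_act h₂ h₃u ha⟩⟩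
  have hP : P = act γ₂⁻¹ γ₃⁻¹ (act γ₂ γ₃ P) := by
    rw [← act_mul_mul, Matrix.nonsing_inv_mul γ₂ h₂, Matrix.nonsing_inv_mul γ₃ h₃u, act_one_one]
  rw [hP]
  exact resolvent_aniso_act (Matrix.isUnit_nonsing_inv_det_iff.mpr h₂)
    (Matrix.isUnit_nonsing_inv_det_iff.mpr h₃u) ha

/-- For `φ(f)`: the doubled resolvent form is `2 g_f`, so `φ(f)` is absolutely irreducible iff
`f` has no zero-related obstruction: precisely, iff the conics have no common rational zero and
`g_f` has no zero in `ℙ¹(ℚ)`; the point `(1 : 0)` is never a zero (`g_f` is monic). [folklore] -/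
theorem isAbsIrreducible_ofQuartic_iff (f : BinaryQuartic ℤ) :
    IsAbsIrreducible (ofQuartic f) ↔ ¬ HasCommonRatZero (ofQuartic f) ∧
      ∀ t : ℚ, t ^ 3 + f.c * t ^ 2 + (f.b * f.d - 4 * f.a * f.e) * t
        + (f.a * f.d ^ 2 + f.b ^ 2 * f.e - 4 * f.a * f.c * f.e) ≠ 0 := by
  have key : ∀ x y : ℚ, cubicFormQ (twoResCubic (ofQuartic f)) x y =
      2 * (x ^ 3 + f.c * x ^ 2 * y + (f.b * f.d - 4 * f.a * f.e) * x * y ^ 2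
        + (f.a * f.d ^ 2 + f.b ^ 2 * f.e - 4 * f.a * f.c * f.e) * y ^ 3) := by
    intro x y
    rw [twoResCubic_ofQuartic]
    simp only [cubicFormQ]
    push_cast
    ring
  refine and_congr_right fun _ ↦ ⟨fun h t ht ↦ ?_, fun h x y hxy hzero ↦ ?_⟩
  · refine h t 1 (Or.inr one_ne_zero) ?_
    rw [key]
    linear_combination 2 * ht
  · rw [key] at hzero
    have hz : x ^ 3 + f.c * x ^ 2 * y + (f.b * f.d - 4 * f.a * f.e) * x * y ^ 2
        + (f.a * f.d ^ 2 + f.b ^ 2 * f.e - 4 * f.a * f.c * f.e) * y ^ 3 = 0 := by linarith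
    by_cases hy : y = 0
    · subst hy
      have hx : x ≠ 0 := hxy.resolve_right (not_not.mpr rfl)
      have : x ^ 3 = 0 := by simpa using hz
      exact hx (pow_eq_zero_iff (n := 3) (by norm_num) |>.mp this)
    · apply h (x / y)
      have hy3 : y ^ 3 ≠ 0 := pow_ne_zero 3 hy
      field_simp
      linear_combination hz

end TernaryPairs

end Literature.NumberTheory.EllipticCurves

end
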